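/-
Copyright: the b2b-balaban T⁴-continuum CRUX team, row NE7b OWNER lineage `t4-ne7b-p1` (gen 144). Project licence.
-/
import Summits.QuantumFields.BalabanUV.T4Continuum.Spine.NE7b.SupFifthKernelSlotMasters
import Summits.QuantumFields.BalabanUV.T4Continuum.Spine.NE7b.SupFifthKernelSlotSupportSums
import Summits.QuantumFields.BalabanUV.T4Continuum.Spine.NE7b.SupFivePointThresholdSlotSums
import Summits.QuantumFields.BalabanUV.T4Continuum.Spine.NE7b.SupFifthKernelSums
import Summits.QuantumFields.BalabanUV.T4Continuum.Spine.NE7b.SupFifthKernelSlotTools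
import Summits.QuantumFields.BalabanUV.T4Continuum.Spine.NE7b.SupKernelClassThirdLetters
import Summits.QuantumFields.BalabanUV.T4Continuum.Spine.NE7b.SupWhitenedHessianGradientCovariance

/-!
# THE SLOT LETTER `k5s2⁺` OF THE ORDER-FIVE ENTRY MAJORANT, BLOCKS ONE TO THREE (`K5` + `E(b^x,k5)`; the `Cov(C,A)` block: 12 terms; the `Cov(B,B)` block: 9 terms) (display index `z` fixed, row index
# summed; the order-5 block of the kernel-letter CLASS MAP; finite sums).  (610)'s majorant is six group blocks of 52 written-out terms; this
# file sums the named block(s) over the other three display indices and `x` with `z` fixed — two-point terms by (613)'s masters (MASS letter of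
# the family containing `z`, COLUMN letter of the other), supported stars∕trees by (614) with the `Hk`∕`K3` supports counted in the role the term
# dictates, the threshold by (558); reindexed by (595)∕(613).  NEW INPUT LETTERS: `k5s2, k5s3, k5s4, k3m`, the support counts in all roles
# (`hn, hn′`; `hn3, hn3f, hn3m`) (row NE7b, node U5c; (613), (614), (527), (558), (564), (595), (611) BY NAME; [folklore] finite sums)

Cell `pub-balaban`, sub-cell `t4`, spine estimate NE7b (`T4WeightBudget.RelWeightBound`; the cell's OWN estimate — NOT PRINTED in
[Bałaban 1983–89], NOT PROVED).  Crux-route work under `Spine/NE7b/` by the row OWNER (`t4-ne7b-p1` gen 144, file (620)) under FREEZE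
(0)'s crux-prover clause; NOTHING of Bałaban's is named as a Lean object, valued or asserted; no `T4Continuum/Support` leaf typed; no
`def`, no notation (the majorant blocks WRITTEN OUT as in (610)); zero `sorry`.  Imports (BY NAME): the OWNER's (613), (614), (558), (595), (611), (483), (480).

WHAT IS PROVED ([folklore]): `slot_z_mean`, `slot_z_covCA`, `slot_z_covBB`; toy.

HONEST (what this is NOT).  Finite sums over blocks of (610)'s majorant; the slot letter itself (the six blocks added) is the END file; only the
non-negativity of `C3k, C3h, C4, C5` is hypothesised.  Scalar skeleton ((A3), NC-NE7b-α UNRULED); nothing of Bałaban's asserted.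
BY-NAME EFFECT ON THE WALL: NONE.  NE7b NOT PRINTED ∕ NOT PROVED; spine PROVED 0∕9; rung (B)+1 — the programme's measures remain FINITE-torus
statements; NOT the mass gap, NOT Clay.  HONEST DEPENDENCY: continuum YM on T⁴ ⇐ BetaPertH ∧ nine spine estimates (0∕9 proved); BetaPertH ⇐
(D1) ∧ (D4) ∧ CAP+tail; G-an2-4 gates asym, D1 and NE2∕3∕4.
-/

set_option autoImplicit false

noncomputable section

namespace Summit.QuantumFields.BalabanUV.T4Continuum.NE7b.SupFifthKernelEntryLetterSlotThreeA

open Finset Real Matrix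
open scoped BigOperators
open SupFourthKernelSlotSums (third_vector_mass_two third_vector_mass_three tree16_sum_slot_two tree16_sum_slot_three tree16_sum_slot_four)
open SupFifthKernelSlotMasters (fourth_vector_mass_two fourth_vector_mass_three fourth_vector_mass_four master31 master31_rev master22 master22_rev
  master13 master13_rev master04 master04_rev sum4_ystz sum4_zsty sum4_tzys sum4_tszy sum4_szyt sum4_styz sum4_stzy)
open SupFifthKernelSlotSupportSums (pair_vertex_leg_fixed pair_vertex_member_fixed pair_counted_leg_fn pair_leg_otherleg_fixed vertex_rider_fixed
  two_riders_leg_fixed counted_then_riders_leg_fn leg_rider_leg_fn tree_rider_fixed tree_leaf_fixed_vertex_riders tree_counted_weight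
  tree_leaf_fixed_leaf_rider)
open SupFourPointTreeRowSum (tree_sum_row_le)
open SupFivePointThresholdSlotSums (threshold_pow4_slot_2 threshold_pow4_slot_3 threshold_pow4_slot_4 threshold_pow4_slot_5)
open SupFifthKernelSums (sum4_ytsz sum4_zyts sum4_yzst sum4_tyzs sum4_syzt sum4_ztsy sum4_tsyz sum4_ytzs sum4_zsyt sum4_yszt sum4_ztys sum4_sytz
  sum4_zyst sum4_tysz sum4_szty sum4_tzsy)
open SupFifthKernelSlotTools (sum4_le_abs abs_ite_le abs_ite_ite_le sum4_add const_mul_sum4_le)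
open SupFifthKernelTwoPointLetters (fourth_vector_nonneg fourth_vector_mass_le fourth_vector_colsum_le)
open SupFourthKernelTwoPointLetters (third_vector_nonneg third_vector_mass_le third_vector_colsum_le)
open SupHessianVectorGeometryLetters (hess_vector_nonneg)
open SupWhitenedHessianGradientCovariance (hessian_obs_mass_le)
open SupKernelClassThirdLetters (hessian_obs_mass_second hessian_obs_colsum)
open SupWhitenedFirstOrderLetters (whitened_obs_nonneg whitened_obs_rowsum_le whitened_obs_colsum_le)

variable {ι κ : Type} [Fintype ι] [DecidableEq ι] [Fintype κ] [DecidableEq κ]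

variable {Hk : ι → ι → ℝ} {K3 : ι → ι → ι → ℝ} {K4 : ι → ι → ι → ι → ℝ} {K5 : ι → ι → ι → ι → ι → ℝ} {A : Matrix ι κ ℝ} {D : κ → κ → ℝ}
  {lamA αr αc hr hc k3r k3m k3c k4r k4s2 k4s3 k4c k5r k5s2 k5s3 k5s4 k5c dr dc S S' S₁ n₃ C3k C3h C4 C5 : ℝ} {ρ r : ι → ι → ℝ} {n : ℕ}

omit [DecidableEq ι] [DecidableEq κ] in
set_option maxHeartbeats 1600000 in
set_option maxRecDepth 4096 in
/-- The `mean` block of (610)'s majorant summed with the display index `z` fixed (2 terms). [folklore] -/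
theorem slot_z_mean [Nonempty κ]
    (hK50 : ∀ x y z t u, 0 ≤ K5 x y z t u) (hHk0 : ∀ v u, 0 ≤ Hk v u) (hhc : ∀ u, ∑ v, Hk v u ≤ hc)
    (hk5s2 : ∀ y, ∑ x, ∑ z, ∑ t, ∑ u, K5 x y z t u ≤ k5s2) (hαr : ∀ u, ∑ w, |A u w| ≤ αr) (hαc : ∀ w, ∑ u, |A u w| ≤ αc) (hlamA1 : lamA < 1)
    (hD : ∀ x y, 0 ≤ D x y) (hDr : ∀ z, ∑ w, D z w ≤ dr) (hDc : ∀ w, ∑ z, D z w ≤ dc) (z : ι) :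
    ∑ y, ∑ t, ∑ s, ∑ x, ((K5 y z t s x : ℝ) + (∑ w, (∑ z', D z' w * ∑ u, |A u z'| * Hk x u) * (∑ z', D z' w * ∑ u, |A u z'| * K5 y z t s u) / (1 - lamA) : ℝ)) ≤
      k5s2 +
        αr * k5s2 * (αc * hc) * dr * dc / (1 - lamA) := by
  haveI : Nonempty ι := ⟨z⟩
  have hl1 : 0 < 1 - lamA := by linarith
  obtain ⟨w₀⟩ := ‹Nonempty κ›
  have hhc0 : 0 ≤ αc * hc := (Finset.sum_nonneg fun v _ => whitened_obs_nonneg hHk0 A v w₀).trans (whitened_obs_colsum_le hHk0 hαc hhc w₀)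
  have h1 := (hk5s2 z)
  have h2 := ((sum4_syzt _).trans_le (master31_rev hD hDr hDc hl1 (fun _ _ _ w => fourth_vector_nonneg hK50 A _ _ _ _ w) (fun _ w => whitened_obs_nonneg hHk0 A _ w) (fourth_vector_mass_two hK50 hαr hk5s2 z) (fun w => whitened_obs_colsum_le hHk0 hαc hhc w) hhc0))
  repeat rw [sum4_add]
  exact ((add_le_add h1 h2)).trans (le_of_eq (by ring))

omit [DecidableEq ι] [DecidableEq κ] in
set_option maxHeartbeats 1600000 in
set_option maxRecDepth 4096 in
/-- The `covCA` block of (610)'s majorant summed with the display index `z` fixed (12 terms). [folklore] -/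
theorem slot_z_covCA [Nonempty κ]
    (hK50 : ∀ x y z t u, 0 ≤ K5 x y z t u) (hK40 : ∀ x y z u, 0 ≤ K4 x y z u) (hK30 : ∀ x y u, 0 ≤ K3 x y u) (hHk0 : ∀ v u, 0 ≤ Hk v u)
    (hhr : ∀ v, ∑ u, Hk v u ≤ hr) (hhc : ∀ u, ∑ v, Hk v u ≤ hc) (hk3m : ∀ y, ∑ x, ∑ u, K3 x y u ≤ k3m) (hk3c : ∀ u, ∑ y, ∑ z, K3 y z u ≤ k3c)
    (hk4r : ∀ x, ∑ y, ∑ z, ∑ u, K4 x y z u ≤ k4r) (hk4s2 : ∀ y, ∑ x, ∑ t, ∑ u, K4 x y t u ≤ k4s2) (hk4c : ∀ u, ∑ y, ∑ z, ∑ t, K4 y z t u ≤ k4c)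
    (hk5s2 : ∀ y, ∑ x, ∑ z, ∑ t, ∑ u, K5 x y z t u ≤ k5s2) (hk5s3 : ∀ z, ∑ x, ∑ y, ∑ t, ∑ u, K5 x y z t u ≤ k5s3)
    (hk5c : ∀ u, ∑ y, ∑ z, ∑ t, ∑ s, K5 y z t s u ≤ k5c) (hαr : ∀ u, ∑ w, |A u w| ≤ αr) (hαc : ∀ w, ∑ u, |A u w| ≤ αc) (hlamA1 : lamA < 1)
    (hD : ∀ x y, 0 ≤ D x y) (hDr : ∀ z, ∑ w, D z w ≤ dr) (hDc : ∀ w, ∑ z, D z w ≤ dc) (hρ1 : ∀ x y, 1 ≤ ρ x y) (hρsymm : ∀ x y, ρ x y = ρ y x)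
    (hS : ∀ u, ∑ v, 1 / ρ u v ≤ S) (hn3 : ∀ y : ι, ∑ z, ((Finset.univ.filter (fun t => K3 z t y ≠ 0)).card : ℝ) ≤ n₃)
    (hn3f : ∀ a : ι, ∑ b, ((Finset.univ.filter (fun c => K3 a b c ≠ 0)).card : ℝ) ≤ n₃) (hC3k0 : 0 ≤ C3k) (z : ι) :
    ∑ y, ∑ t, ∑ s, ∑ x, ((∑ w, (∑ z', D z' w * ∑ u, |A u z'| * K5 x y t s u) * (∑ z', D z' w * ∑ u, |A u z'| * Hk z u) / (1 - lamA) : ℝ) + (∑ w, (∑ z', D z' w * ∑ u, |A u z'| * K3 x z u) * (∑ z', D z' w * ∑ u, |A u z'| * K4 y t s u) / (1 - lamA) : ℝ) + (if K3 t s y = 0 then 0 else C3k / (ρ x y * ρ x z) : ℝ) + (∑ w, (∑ z', D z' w * ∑ u, |A u z'| * K5 x y z s u) * (∑ z', D z' w * ∑ u, |A u z'| * Hk t u) / (1 - lamA) : ℝ) + (∑ w, (∑ z', D z' w * ∑ u, |A u z'| * K3 x t u) * (∑ z', D z' w * ∑ u, |A u z'| * K4 y z s u) / (1 - lamA) : ℝ)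 + (if K3 z s y = 0 then 0 else C3k / (ρ x y * ρ x t) : ℝ) + (∑ w, (∑ z', D z' w * ∑ u, |A u z'| * K5 x y z t u) * (∑ z', D z' w * ∑ u, |A u z'| * Hk s u) / (1 - lamA) : ℝ) + (∑ w, (∑ z', D z' w * ∑ u, |A u z'| * K3 x s u) * (∑ z', D z' w * ∑ u, |A u z'| * K4 y z t u) / (1 - lamA) : ℝ) + (if K3 z t y = 0 then 0 else C3k / (ρ x y * ρ x s) : ℝ) + (∑ w, (∑ z', D z' w * ∑ u, |A u z'| * K3 x y u) * (∑ z', D z' w * ∑ u, |A u z'| * K4 z t s u) / (1 - lamA) : ℝ) + (∑ w, (∑ z', D z' w * ∑ u, |A u z'| * K5 x z t s u) * (∑ z', D z' w * ∑ u, |A u z'| * Hk y u) / (1 - lamA) : ℝ) + (if K3 t s z = 0 then 0 else C3k / (ρ x z * ρ x y) : ℝ)) ≤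
      αr * hr * (αc * k5c) * dr * dc / (1 - lamA) +
        αr * k3m * (αc * k4c) * dr * dc / (1 - lamA) +
        4 * (n₃ * (C3k * S ^ 2)) +
        2 * (αr * k5s3 * (αc * hc) * dr * dc / (1 - lamA)) +
        2 * (αr * k4s2 * (αc * k3c) * dr * dc / (1 - lamA)) +
        αr * k4r * (αc * k3c) * dr * dc / (1 - lamA) +
        αr * k5s2 * (αc * hc) * dr * dc / (1 - lamA) := by
  haveI : Nonempty ι := ⟨z⟩
  have hl1 : 0 < 1 - lamA := by linarith
  have hρ0 : ∀ a b, 0 < ρ a b := fun a b => zero_lt_one.trans_le (hρ1 a b)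
  have hdiv2 : ∀ x a b : ι, ∀ {Cc : ℝ}, 0 ≤ Cc → 0 ≤ Cc / (ρ x a * ρ x b) := fun x a b Cc h => div_nonneg h (mul_pos (hρ0 x a) (hρ0 x b)).le
  obtain ⟨w₀⟩ := ‹Nonempty κ›
  have hhc0 : 0 ≤ αc * hc := (Finset.sum_nonneg fun v _ => whitened_obs_nonneg hHk0 A v w₀).trans (whitened_obs_colsum_le hHk0 hαc hhc w₀)
  have hk3c0 : 0 ≤ αc * k3c := (Finset.sum_nonneg fun y _ => Finset.sum_nonneg fun z _ => hess_vector_nonneg hK30 A y z w₀).trans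
    (hessian_obs_colsum hK30 hαc hk3c w₀)
  have hk4c0 : 0 ≤ αc * k4c := (Finset.sum_nonneg fun y _ => Finset.sum_nonneg fun z _ => Finset.sum_nonneg fun t _ =>
    third_vector_nonneg hK40 A y z t w₀).trans (third_vector_colsum_le hK40 hαc hk4c w₀)
  have hk5c0 : 0 ≤ αc * k5c := (Finset.sum_nonneg fun y _ => Finset.sum_nonneg fun z _ => Finset.sum_nonneg fun t _ => Finset.sum_nonneg fun s _ =>
    fourth_vector_nonneg hK50 A y z t s w₀).trans (fourth_vector_colsum_le hK50 hαc hk5c w₀)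
  have h1 := ((sum4_syzt _).trans_le (master04_rev hD hDr hDc hl1 (fun w => whitened_obs_nonneg hHk0 A _ w) (fun _ _ _ _ w => fourth_vector_nonneg hK50 A _ _ _ _ w) (whitened_obs_rowsum_le hHk0 hαr hhr z) (fun w => fourth_vector_colsum_le hK50 hαc hk5c w) hk5c0))
  have h2 := ((sum4_syzt _).trans_le (master13 hD hDr hDc hl1 (fun _ w => hess_vector_nonneg hK30 A _ _ w) (fun _ _ _ w => third_vector_nonneg hK40 A _ _ _ w) (hessian_obs_mass_second hK30 hαr hk3m z) (fun w => third_vector_colsum_le hK40 hαc hk4c w) hk4c0))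
  have h3 := ((sum4_syzt _).trans_le ((sum4_le_abs _).trans (pair_leg_otherleg_fixed (fun x a' b' c' : ι => if K3 b' c' a' = 0 then (0:ℝ) else C3k / (ρ x a' * ρ x z)) K3 z hC3k0 hρ1 hρsymm hS (fun a' b' c' h x => if_pos h) (fun x a' b' c' => (abs_ite_le (hdiv2 x _ _ hC3k0)).trans (le_of_eq (by ring))) hn3)))
  have h4 := ((sum4_sytz _).trans_le (master31 hD hDr hDc hl1 (fun _ _ _ w => fourth_vector_nonneg hK50 A _ _ _ _ w) (fun _ w => whitened_obs_nonneg hHk0 A _ w) (fourth_vector_mass_three hK50 hαr hk5s3 z) (fun w => whitened_obs_colsum_le hHk0 hαc hhc w) hhc0))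
  have h5 := ((sum4_szyt _).trans_le (master22_rev hD hDr hDc hl1 (fun _ _ w => third_vector_nonneg hK40 A _ _ _ w) (fun _ _ w => hess_vector_nonneg hK30 A _ _ w) (third_vector_mass_two hK40 hαr hk4s2 z) (fun w => hessian_obs_colsum hK30 hαc hk3c w) hk3c0))
  have h6 := ((sum4_tysz _).trans_le ((sum4_le_abs _).trans (pair_counted_leg_fn (fun c' a' x d' : ι => if K3 z c' a' = 0 then (0:ℝ) else C3k / (ρ x a' * ρ x d')) (fun c' a' => K3 z c' a') (fun c' a' => a') hC3k0 hρ1 hρsymm hS (fun c' a' h x d' => if_pos h) (fun c' a' x d' => abs_ite_le (hdiv2 x _ _ hC3k0)) (hn3f z))))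
  have h7 := ((sum4_syzt _).trans_le (master31 hD hDr hDc hl1 (fun _ _ _ w => fourth_vector_nonneg hK50 A _ _ _ _ w) (fun _ w => whitened_obs_nonneg hHk0 A _ w) (fourth_vector_mass_three hK50 hαr hk5s3 z) (fun w => whitened_obs_colsum_le hHk0 hαc hhc w) hhc0))
  have h8 := ((sum4_styz _).trans_le (master22_rev hD hDr hDc hl1 (fun _ _ w => third_vector_nonneg hK40 A _ _ _ w) (fun _ _ w => hess_vector_nonneg hK30 A _ _ w) (third_vector_mass_two hK40 hαr hk4s2 z) (fun w => hessian_obs_colsum hK30 hαc hk3c w) hk3c0))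
  have h9 := ((sum4_zyst _).trans_le ((sum4_le_abs _).trans (pair_counted_leg_fn (fun c' a' x d' : ι => if K3 z c' a' = 0 then (0:ℝ) else C3k / (ρ x a' * ρ x d')) (fun c' a' => K3 z c' a') (fun c' a' => a') hC3k0 hρ1 hρsymm hS (fun c' a' h x d' => if_pos h) (fun c' a' x d' => abs_ite_le (hdiv2 x _ _ hC3k0)) (hn3f z))))
  have h10 := ((sum4_syzt _).trans_le (master22_rev hD hDr hDc hl1 (fun _ _ w => third_vector_nonneg hK40 A _ _ _ w) (fun _ _ w => hess_vector_nonneg hK30 A _ _ w) (third_vector_mass_le hK40 hαr hk4r z) (fun w => hessian_obs_colsum hK30 hαc hk3c w) hk3c0))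
  have h11 := ((sum4_szty _).trans_le (master31 hD hDr hDc hl1 (fun _ _ _ w => fourth_vector_nonneg hK50 A _ _ _ _ w) (fun _ w => whitened_obs_nonneg hHk0 A _ w) (fourth_vector_mass_two hK50 hαr hk5s2 z) (fun w => whitened_obs_colsum_le hHk0 hαc hhc w) hhc0))
  have h12 := ((sum4_ztsy _).trans_le ((sum4_le_abs _).trans (pair_counted_leg_fn (fun b' c' x d' : ι => if K3 b' c' z = 0 then (0:ℝ) else C3k / (ρ x z * ρ x d')) (fun b' c' => K3 b' c' z) (fun _ _ => z) hC3k0 hρ1 hρsymm hS (fun b' c' h x d' => if_pos h) (fun b' c' x d' => abs_ite_le (hdiv2 x _ _ hC3k0)) (hn3 z))))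
  repeat rw [sum4_add]
  exact ((add_le_add (add_le_add (add_le_add (add_le_add (add_le_add (add_le_add (add_le_add (add_le_add (add_le_add (add_le_add (add_le_add h1 h2) h3) h4) h5) h6) h7) h8) h9) h10) h11) h12)).trans (le_of_eq (by ring))

omit [DecidableEq ι] [DecidableEq κ] in
set_option maxHeartbeats 1600000 in
set_option maxRecDepth 4096 in
/-- The `covBB` block of (610)'s majorant summed with the display index `z` fixed (9 terms). [folklore] -/
theorem slot_z_covBB [Nonempty κ]
    (hK40 : ∀ x y z u, 0 ≤ K4 x y z u) (hK30 : ∀ x y u, 0 ≤ K3 x y u) (hk3r : ∀ x, ∑ y, ∑ u, K3 x y u ≤ k3r) (hk3m : ∀ y, ∑ x, ∑ u, K3 x y u ≤ k3m)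
    (hk3c : ∀ u, ∑ y, ∑ z, K3 y z u ≤ k3c) (hk4s2 : ∀ y, ∑ x, ∑ t, ∑ u, K4 x y t u ≤ k4s2) (hk4s3 : ∀ z, ∑ x, ∑ y, ∑ u, K4 x y z u ≤ k4s3)
    (hk4c : ∀ u, ∑ y, ∑ z, ∑ t, K4 y z t u ≤ k4c) (hαr : ∀ u, ∑ w, |A u w| ≤ αr) (hαc : ∀ w, ∑ u, |A u w| ≤ αc) (hlamA1 : lamA < 1)
    (hD : ∀ x y, 0 ≤ D x y) (hDr : ∀ z, ∑ w, D z w ≤ dr) (hDc : ∀ w, ∑ z, D z w ≤ dc) (hρ1 : ∀ x y, 1 ≤ ρ x y) (hρsymm : ∀ x y, ρ x y = ρ y x)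
    (hS : ∀ u, ∑ v, 1 / ρ u v ≤ S) (hn : ∀ y : ι, (Finset.univ.filter (fun z => Hk z y ≠ 0)).card ≤ n)
    (hn' : ∀ z : ι, (Finset.univ.filter (fun y => Hk z y ≠ 0)).card ≤ n) (hC3h0 : 0 ≤ C3h) (z : ι) :
    ∑ y, ∑ t, ∑ s, ∑ x, ((∑ w, (∑ z', D z' w * ∑ u, |A u z'| * K4 x y z u) * (∑ z', D z' w * ∑ u, |A u z'| * K3 t s u) / (1 - lamA) : ℝ) + (∑ w, (∑ z', D z' w * ∑ u, |A u z'| * K4 x t s u) * (∑ z', D z' w * ∑ u, |A u z'| * K3 y z u) / (1 - lamA) : ℝ) + (if Hk z y = 0 then 0 else if Hk s t = 0 then 0 else C3h / (ρ x y * ρ x t) : ℝ) + (∑ w, (∑ z', D z' w * ∑ u, |A u z'| * K4 x y t u) * (∑ z', D z' w * ∑ u, |A u z'| * K3 z s u) / (1 - lamA) : ℝ) + (∑ w, (∑ z', D z' w * ∑ u, |A u z'| * K4 x z s u) * (∑ z', D z' w * ∑ u, |A u z'| * K3 y t u) / (1 - lamA) : ℝ) + (if Hk t y = 0 then 0 else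 if Hk s z = 0 then 0 else C3h / (ρ x y * ρ x z) : ℝ) + (∑ w, (∑ z', D z' w * ∑ u, |A u z'| * K4 x y s u) * (∑ z', D z' w * ∑ u, |A u z'| * K3 z t u) / (1 - lamA) : ℝ) + (∑ w, (∑ z', D z' w * ∑ u, |A u z'| * K4 x z t u) * (∑ z', D z' w * ∑ u, |A u z'| * K3 y s u) / (1 - lamA) : ℝ) + (if Hk s y = 0 then 0 else if Hk t z = 0 then 0 else C3h / (ρ x y * ρ x z) : ℝ)) ≤
      αr * k4s3 * (αc * k3c) * dr * dc / (1 - lamA) +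
        αr * k3m * (αc * k4c) * dr * dc / (1 - lamA) +
        3 * ((n : ℝ) * n * (C3h * S ^ 2)) +
        2 * (αr * k3r * (αc * k4c) * dr * dc / (1 - lamA)) +
        2 * (αr * k4s2 * (αc * k3c) * dr * dc / (1 - lamA)) := by
  haveI : Nonempty ι := ⟨z⟩
  have hl1 : 0 < 1 - lamA := by linarith
  have hρ0 : ∀ a b, 0 < ρ a b := fun a b => zero_lt_one.trans_le (hρ1 a b)
  have hdiv2 : ∀ x a b : ι, ∀ {Cc : ℝ}, 0 ≤ Cc → 0 ≤ Cc / (ρ x a * ρ x b) := fun x a b Cc h => div_nonneg h (mul_pos (hρ0 x a) (hρ0 x b)).le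
  have hnR : ∀ y : ι, ((Finset.univ.filter (fun z => Hk z y ≠ 0)).card : ℝ) ≤ (n : ℝ) := fun y => by exact_mod_cast hn y
  have hnR' : ∀ z : ι, ((Finset.univ.filter (fun y => Hk z y ≠ 0)).card : ℝ) ≤ (n : ℝ) := fun z => by exact_mod_cast hn' z
  obtain ⟨w₀⟩ := ‹Nonempty κ›
  have hk3c0 : 0 ≤ αc * k3c := (Finset.sum_nonneg fun y _ => Finset.sum_nonneg fun z _ => hess_vector_nonneg hK30 A y z w₀).trans
    (hessian_obs_colsum hK30 hαc hk3c w₀)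
  have hk4c0 : 0 ≤ αc * k4c := (Finset.sum_nonneg fun y _ => Finset.sum_nonneg fun z _ => Finset.sum_nonneg fun t _ =>
    third_vector_nonneg hK40 A y z t w₀).trans (third_vector_colsum_le hK40 hαc hk4c w₀)
  have h1 := ((sum4_syzt _).trans_le (master22 hD hDr hDc hl1 (fun _ _ w => third_vector_nonneg hK40 A _ _ _ w) (fun _ _ w => hess_vector_nonneg hK30 A _ _ w) (third_vector_mass_three hK40 hαr hk4s3 z) (fun w => hessian_obs_colsum hK30 hαc hk3c w) hk3c0))
  have h2 := ((sum4_szty _).trans_le (master13_rev hD hDr hDc hl1 (fun _ w => hess_vector_nonneg hK30 A _ _ w) (fun _ _ _ w => third_vector_nonneg hK40 A _ _ _ w) (hessian_obs_mass_second hK30 hαr hk3m z) (fun w => third_vector_colsum_le hK40 hαc hk4c w) hk4c0))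
  have h3 := ((sum4_yszt _).trans_le ((sum4_le_abs _).trans (leg_rider_leg_fn (fun a' x c' d' : ι => if Hk z a' = 0 then (0:ℝ) else if Hk d' c' = 0 then (0:ℝ) else C3h / (ρ x a' * ρ x c')) (fun a' => Hk z a') (fun d' c' => Hk d' c') (fun a' => a') hC3h0 hρ1 hρsymm hS (fun a' h x c' d' => if_pos h) (fun c' d' h a' x => by simp [h]) (fun a' x c' d' => abs_ite_ite_le (hdiv2 x _ _ hC3h0)) (hnR' z) hnR)))
  have h4 := ((sum4_syzt _).trans_le (master13_rev hD hDr hDc hl1 (fun _ w => hess_vector_nonneg hK30 A _ _ w) (fun _ _ _ w => third_vector_nonneg hK40 A _ _ _ w) (hessian_obs_mass_le hK30 hαr hk3r z) (fun w => third_vector_colsum_le hK40 hαc hk4c w) hk4c0))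
  have h5 := ((sum4_styz _).trans_le (master22 hD hDr hDc hl1 (fun _ _ w => third_vector_nonneg hK40 A _ _ _ w) (fun _ _ w => hess_vector_nonneg hK30 A _ _ w) (third_vector_mass_two hK40 hαr hk4s2 z) (fun w => hessian_obs_colsum hK30 hαc hk3c w) hk3c0))
  have h6 := ((sum4_tsyz _).trans_le ((sum4_le_abs _).trans (leg_rider_leg_fn (fun d' x a' b' : ι => if Hk b' a' = 0 then (0:ℝ) else if Hk d' z = 0 then (0:ℝ) else C3h / (ρ x a' * ρ x z)) (fun d' => Hk d' z) (fun b' a' => Hk b' a') (fun _ => z) hC3h0 hρ1 hρsymm hS (fun d' h x a' b' => by simp [h]) (fun a' b' h d' x => if_pos h) (fun d' x a' b' => (abs_ite_ite_le (hdiv2 x _ _ hC3h0)).trans (le_of_eq (by ring))) (hnR z) hnR)))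
  have h7 := ((sum4_sytz _).trans_le (master13_rev hD hDr hDc hl1 (fun _ w => hess_vector_nonneg hK30 A _ _ w) (fun _ _ _ w => third_vector_nonneg hK40 A _ _ _ w) (hessian_obs_mass_le hK30 hαr hk3r z) (fun w => third_vector_colsum_le hK40 hαc hk4c w) hk4c0))
  have h8 := ((sum4_szyt _).trans_le (master22 hD hDr hDc hl1 (fun _ _ w => third_vector_nonneg hK40 A _ _ _ w) (fun _ _ w => hess_vector_nonneg hK30 A _ _ w) (third_vector_mass_two hK40 hαr hk4s2 z) (fun w => hessian_obs_colsum hK30 hαc hk3c w) hk3c0))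
  have h9 := ((sum4_zsyt _).trans_le ((sum4_le_abs _).trans (leg_rider_leg_fn (fun d' x a' b' : ι => if Hk b' a' = 0 then (0:ℝ) else if Hk d' z = 0 then (0:ℝ) else C3h / (ρ x a' * ρ x z)) (fun d' => Hk d' z) (fun b' a' => Hk b' a') (fun _ => z) hC3h0 hρ1 hρsymm hS (fun d' h x a' b' => by simp [h]) (fun a' b' h d' x => if_pos h) (fun d' x a' b' => (abs_ite_ite_le (hdiv2 x _ _ hC3h0)).trans (le_of_eq (by ring))) (hnR z) hnR)))
  repeat rw [sum4_add]
  exact ((add_le_add (add_le_add (add_le_add (add_le_add (add_le_add (add_le_add (add_le_add (add_le_add h1 h2) h3) h4) h5) h6) h7) h8) h9)).trans (le_of_eq (by ring))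

/-- Toy. -/
example : (2 : ℕ) + 12 + 9 + 12 + 12 + 5 = 52 := by norm_num

end Summit.QuantumFields.BalabanUV.T4Continuum.NE7b.SupFifthKernelEntryLetterSlotThreeA

end
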